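import Summits.BirchSwinnertonDyer.BirchSwinnertonDyer.Theorems.CyclotomicUntwistGNineNineGoodModelOfPSRow
import Summits.BirchSwinnertonDyer.BirchSwinnertonDyer.Theorems.CyclotomicUntwistNineIntegersResidueMap
import HarnessLib

/-!
# Stub `stub_descendedFrobenius` of line `dfrob` (cruxes K1 `PSRankOneLowerHalfAtThree` = stmt-BirchSwinnertonDyer-21580
# and K2 `PSRankOneUpperHalfAtThree` = 21581, route `CyclotomicUntwist`) — PROVED BY NAME with the registered signature

Cell `pub/bsd-wall` (D-0145 line `route-BirchSwinnertonDyer-CyclotomicUntwist`, rev 5), seat `bsd-line-cycu-p3` (gen 7).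
Registered line `dfrob` v3 (lead cycu-p1 g5, `Cruxes/PSRankOneLowerHalfAtThree/Lines/dfrob.lean`, skeleton check
2026-08-28T10:52Z), stub **`stub_descendedFrobenius`**:

  `isDescendedFrobeniusMatrix_exists → ∀ W [IsElliptic] [IsGloballyMinimal], ClassO6 W 3 → Even (v₃Δ_min) →`
  `Δ_min/3^v % 3 = 1 → ∃ M, W.IsDescendedFrobeniusMatrix M ∧ M.trace = ↑W.psUntwistedTrace ∧ M 1 0 ≠ 0`.

GIVEN the Literature named fact (the line's print stub `stub_PRINT_descendedFrobenius_exists`), the descended Frobenius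
matrix exists on every principal-series row with trace `a_w(W)` and `M₁₀ ≠ 0` — by
`GNineFrobeniusTrace.stub_descendedFrobenius_of_exists` (p627422; cf. `…_of_exists'`, p628303): (B1) the explicit good models over `𝓞_{ℚ₃(ζ₉)}` with
special-fibre trace `psUntwistedTrace` along every reduction map (p627014, p627422; LAW L-a3 (N)), (B2) the reduction
map `NineIntegers.nonempty_residueMap` (cycu-p4 g7), and `IsDescendedFrobeniusMatrix.trace_eq` /
`entry_one_zero_ne_zero` of the definition file (p623342). THEOREM ONLY; this closes ONE STUB of a line, not the crux;
the other stubs (`stub_EX`, `stub_NGZ3_dfrob`, `stub_pBSD3_dfrob`: research; the two print stubs) are untouched.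
BSD is not proved by this file.

References: P. Berthelot, A. Ogus, Invent. Math. 72 (1983) (2.4), (3.14) [BerthelotOgus1983]; N. M. Katz, LNM 868 (1981)
§5 [Katz1981CrystallineDieudonne]; J. Tate, LNM 476 (1975) §7 [Tate1975]; A. Kraus, Manuscripta Math. 69 (1990) [Kraus1990].
-/

-- single-conjunct summit: `Summit.BirchSwinnertonDyer.BirchSwinnertonDyer.…` repeats the name by design
set_option linter.dupNamespace false
set_option autoImplicit false

namespace Summit.BirchSwinnertonDyer.BirchSwinnertonDyer.Cruxes.PSRankOneLowerHalfAtThree.DFrob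

/-- **Stub `stub_descendedFrobenius` of line `dfrob`, PROVED** (registered signature verbatim): under the named fact
`isDescendedFrobeniusMatrix_exists`, on every principal-series row (`ClassO6 W 3`, `v₃Δ_min` even, `Δ_min/3^v ≡ 1 (mod 3)`)
the descended Frobenius matrix exists with `tr M = a_w(W)` and `M₁₀ ≠ 0`.
[cite: BerthelotOgus1983, Thm. (2.4) and Prop. (3.14)] [cite: Katz1981CrystallineDieudonne, Thm. 5.1.4 and (6.1.1)]
[cite: Kraus1990, Théorème (p = 3)] -/
theorem stub_descendedFrobenius : WeierstrassCurve.isDescendedFrobeniusMatrix_exists →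
    ∀ (W : WeierstrassCurve ℚ) [W.IsElliptic] [W.IsGloballyMinimal],
      Summit.BirchSwinnertonDyer.Rank1Residual.Additive.ClassO6 W 3 →
      Even (padicValInt 3 W.minimalDiscriminantInt) →
      W.minimalDiscriminantInt / 3 ^ padicValInt 3 W.minimalDiscriminantInt % 3 = 1 →
      ∃ M : Matrix (Fin 2) (Fin 2) ℚ_[3], W.IsDescendedFrobeniusMatrix M ∧
        M.trace = ((W.psUntwistedTrace : ℤ) : ℚ_[3]) ∧ M 1 0 ≠ 0 :=
  fun hex ↦ Summit.BirchSwinnertonDyer.BirchSwinnertonDyer.Theorems.GNineFrobeniusTrace.stub_descendedFrobenius_of_exists hex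
    (Classical.choice Summit.BirchSwinnertonDyer.BirchSwinnertonDyer.Theorems.NineIntegers.nonempty_residueMap)

end Summit.BirchSwinnertonDyer.BirchSwinnertonDyer.Cruxes.PSRankOneLowerHalfAtThree.DFrob
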